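import Summits.BirchSwinnertonDyer.BirchSwinnertonDyer.Theorems.PrintCf2RamifiedOffTYZGaloisMotion
import Summits.BirchSwinnertonDyer.Rank1Residual.P2.CongruentNumberGenusDoorsNoGZK
import Literature.NumberTheory.EllipticCurves.MordellWeilRankZeroProofs
import HarnessLib

/-!
# Route `PrintCf2`, crux stmt-BirchSwinnertonDyer-20509 `RamifiedOffTYZOfFacts` — THE GALOIS-MOVER DOOR: a Galois element of
# `ℍ′_n` trivial on `L_n(i)` that MOVES the genus point `P(n)`, plus `#Sel⁽²⁾(E_n/ℚ) = 8`, give `ord_{s=1} L(E_n,s) = 1`,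
# `rank E_n(ℚ) = 1`, `Ш(E_n)[2^∞] = 0` and `BSD(E_n, 2)` — WITHOUT Gross–Zagier–Kolyvagin and WITHOUT a genus-sum parity
# (cell `bsd-print-cf2`, LEAD of 20509 g4, line `offtyz-v7`, lineage cycle 5, sequel of `…GaloisMotion`; fact-free, no `def`)

HONEST FRAMING (crux 20509 DECIDING, OPEN AS A CLASS): every theorem is a kernel implication from the displayed printed
sentences of Tian–Yuan–Zhang 2017 §3 carried by `D : GenusPointData n` (`thm35Main`, `scriptLSpec`, `lemma318` — the
hypotheses the named fact `tyz_genusPointData` provides) and from the tree's proved `2`-descent / Mordell–Weil / BSD-door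
lemmas; nothing is asserted, no count moves.  The NEW INPUT is a hypothesis of a different KIND from every door of the
route so far: not a parity of genus class numbers (TYZ Thm 1.2, the U⁺ / Θ doors) but **the existence of an automorphism
`g` of `ℍ′_n` fixing `i` and every `√−d` (`d ∣ n`) — i.e. trivial on `L_n(i)` — with `g·P(n) ≠ P(n)`.**  The LEAD note
`Cruxes/RamifiedOffTYZOfFacts/Lines/offtyz_v7_TransferLayer.md` computes WHEN such a `g` exists by class field theory (the
transfer identity `…GenusPeriodTransfer` + the 𝔭₂-law: for `n ≡ 5 (mod 8)`, iff the 4-rank of `Cl(ℚ(√−n))` is `0`, or it is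
`1` and the square ambiguous class contains `𝔭₂` — at every divisor entering the recursion); its instrument `k3_layer1.py`
shows that for every odd type with `n ≡ 5 (mod 8)` and `k ≤ 3` prime factors a mover exists EXACTLY when Monsky's
`s(n) = 1`, including two TYZ-SILENT patterns (`n = pqr`, `p ≡ 5`, `q ≡ r ≡ 7 (mod 8)`, `(p/q) = (p/r) = −1`) — there this
door yields rank one and BSD₂ beyond print, once the mover is certified.

* §1 `exists_half_fixed`: the W2 halving `φ_H(Q₁) = ι Θ_E(R)` with an EXPLICIT half whose coordinates lie in
  `ℚ(i, √−n, √−d)` (`d` the square class of `x(R)`, `d ∣ n`): `Q₁` is fixed by every `g` fixing `i` and all `√−d`.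
* §2 `scriptL_ne_zero_of_mover`, `not_isOfFinAddOrder_genusPoint_of_mover`: a mover forces `P(n)` non-torsion and `𝓛(n) ≠ 0`
  (torsion is Galois-inert, `…GaloisMotion`).
* §3 **`rankOne_sha_bsdp_two_congruentNumberCurve_of_selmerEight_of_mover`**: square-free `n ≡ 5, 7 (mod 8)`, `#Sel₂(E_n) = 8`,
  `D` with the three displays, a mover `g` ⟹ `𝓛(n)` odd, `ord_{s=1} L(E_n,s) = 1`, `rank = 1`, `Ш[2^∞] = ⊥`, `BSD(E_n, 2)`.
  (Route: `#Sel₂ = 8` ⟹ rank ≤ 1; rank `0` would make `Q₁`, hence `2P(n) ≡ ±𝓛Q₁`, hence `P(n)` torsion — moved by nobody;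
  so rank `1`; `2 ∣ 𝓛` would make `P(n) ≡ c·Q₁` `g`-fixed; so `𝓛` odd ⟹ `r_an = 1` (`analyticRank_…_of_isScriptL`),
  `Ш[2^∞] = 0` (`#Sel₂ = 8`, rank `1`), and Miller's `BSD(E,2)` by the valuation identity of the no-GZK door.)
* §4 `…_of_genusPointData`: the same keyed on the named fact `tyz_genusPointData`.

Beyond-print theorem: NO at the kernel level (the mover is a hypothesis; certifying it is class field theory of
`ℚ(√−n)` not in the tree).  BSD is not proved by any of this; no class is closed by this file.

References: [cite: TianYuanZhang2017, Thm. 3.5 (p0011 L94–L100), Lemma 3.18 (p0017 L152–L153), §3.1 (p0011 L27–L73)];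
[cite: SilvermanAEC2009, Thm. X.4.2, Prop. X.4.9, Thm. VIII.6.7]; [cite: Miller2011LMS, Def. 1.1]; tree: `…GaloisMotion` (p671505),
`…LevelTwoHalfGenerator` (p665240), `Rank1Residual/P2/CongruentNumberGenusDoorsNoGZK.lean` (the valuation tail, verbatim pattern),
`Literature/…/TianYuanZhang2017/GenusDescentTwist.lean` (`twist_halving`, whose construction §1 makes explicit).
-/

noncomputable section

open scoped Classical

open WeierstrassCurve WeierstrassCurve.Affine Literature.NumberTheory.EllipticCurves
  Literature.NumberTheory.EllipticCurves.Rank1Residual Summit.BirchSwinnertonDyer.Rank1Residual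
  Literature.NumberTheory.EllipticCurves.TianYuanZhang2017
  Literature.NumberTheory.EllipticCurves.TianYuanZhang2017.W2
  Literature.NumberTheory.EllipticCurves.SelmerEightShaTwo
  Summit.BirchSwinnertonDyer.PrintCf2.LevelTwoHalfGenerator

set_option autoImplicit false

namespace Summit.BirchSwinnertonDyer.PrintCf2.GaloisMotion

variable {n : ℕ}

/-! ## §1 An explicit half of the twisted generator, fixed by everything trivial on `L_n(i)` -/

/-- The abscissa of a rational point of `E_n` is the square of an element of `ℚ(i, √−d) ⊂ ℍ′_n` (`d ∣ n` the square class
of `x`), hence of an element FIXED by every automorphism fixing `i` and all `√−d′`, `d′ ∣ n` (the W2 lemma `exists_sq_eq_x`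
with its witness exposed). [cite: TianYuanZhang2017, §3.1 (p0011 L27–L36)] [cite: SilvermanAEC2009, Prop. X.4.9] -/
theorem exists_sq_eq_x_fixed (D : GenusPointData n) (hsq : Squarefree n) {x y : ℚ}
    (h : (congruentNumberCurve n).toAffine.Nonsingular x y) (hx : x ≠ 0) :
    ∃ t : D.H, t ≠ 0 ∧ algebraMap ℚ D.H x = t ^ 2 ∧
      ∀ g : D.H ≃ₐ[ℚ] D.H, g D.im = D.im → (∀ d ∈ n.divisors, g (D.sqrtNeg d) = D.sqrtNeg d) → g t = t := by
  have hn0 : (n : ℤ) ≠ 0 := by exact_mod_cast hsq.ne_zero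
  have hW : congruentNumberCurve n =
      (⟨0, ((0 : ℤ) : ℚ), 0, ((-((n : ℤ) ^ 2) : ℤ) : ℚ), 0⟩ : WeierstrassCurve ℚ) := by
    simp [congruentNumberCurve]
  have hab : (-((n : ℤ) ^ 2)) * ((0 : ℤ) ^ 2 - 4 * (-((n : ℤ) ^ 2))) ≠ 0 := by
    rw [show ((0 : ℤ) ^ 2 - 4 * (-((n : ℤ) ^ 2))) = 4 * (n : ℤ) ^ 2 by ring]
    exact mul_ne_zero (neg_ne_zero.mpr (pow_ne_zero 2 hn0)) (mul_ne_zero (by norm_num) (pow_ne_zero 2 hn0))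
  have hc : sqClass x ∈ Set.range
      (⟨0, ((0 : ℤ) : ℚ), 0, ((-((n : ℤ) ^ 2) : ℤ) : ℚ), 0⟩ : WeierstrassCurve ℚ).xSqClass := by
    refine ⟨Affine.Point.congrEquiv hW (.some x y h), ?_⟩
    rw [Affine.Point.congrEquiv_some, xSqClass_some_of_ne_zero _ hx]
  obtain ⟨d, hdsq, hdvd, hclass⟩ := exists_squarefree_dvd_sqClass_eq hab hc
  have hd0 : (d : ℚ) ≠ 0 := by exact_mod_cast hdsq.ne_zero
  obtain ⟨u, hu⟩ : ∃ u : ℚ, (d : ℚ) * x = u ^ 2 := by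
    rw [← sqClass_eq_one_iff (mul_ne_zero hd0 hx), sqClass_mul hd0 hx, hclass, Affine.SqUnits.mul_self]
  have hdn : d ∣ (n : ℤ) := (hdsq.dvd_pow_iff_dvd two_ne_zero).mp (dvd_neg.mp hdvd)
  have hm : d.natAbs ∈ n.divisors :=
    Nat.mem_divisors.mpr ⟨by simpa using Int.natAbs_dvd_natAbs.mpr hdn, hsq.ne_zero⟩
  have hsm := D.sqrtNeg_sq d.natAbs hm
  have him := D.im_sq
  -- a square root `s` of `d` in `H`, built from `√−|d|` and `i`
  obtain ⟨s, hs, hsfix⟩ : ∃ s : D.H, s ^ 2 = (d : D.H) ∧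
      ∀ g : D.H ≃ₐ[ℚ] D.H, g D.im = D.im → (∀ d ∈ n.divisors, g (D.sqrtNeg d) = D.sqrtNeg d) → g s = s := by
    rcases Int.natAbs_eq d with hd | hd
    · refine ⟨D.sqrtNeg d.natAbs * D.im, ?_, fun g hgi hgd => by rw [map_mul, hgi, hgd _ hm]⟩
      conv_rhs => rw [hd, Int.cast_natCast]
      rw [mul_pow, hsm, him]
      ring
    · refine ⟨D.sqrtNeg d.natAbs, ?_, fun g _ hgd => hgd _ hm⟩
      conv_rhs => rw [hd, Int.cast_neg, Int.cast_natCast]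
      exact hsm
  have hs0 : s ≠ 0 := by
    intro h0; rw [h0, zero_pow two_ne_zero] at hs
    exact (Int.cast_ne_zero.mpr hdsq.ne_zero) hs.symm
  refine ⟨algebraMap ℚ D.H u / s, div_ne_zero (fun hu0 => ?_) hs0, ?_, fun g hgi hgd => ?_⟩
  · rw [map_eq_zero_iff _ (algebraMap ℚ D.H).injective] at hu0
    rw [hu0, zero_pow two_ne_zero, mul_eq_zero] at hu
    exact hu.elim hd0 hx
  · have hux : algebraMap ℚ D.H x * (d : D.H) = algebraMap ℚ D.H u ^ 2 := by
      rw [← map_pow, ← hu, map_mul, map_intCast, mul_comm]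
    rw [div_pow, ← hux, hs, mul_div_assoc, div_self (Int.cast_ne_zero.mpr hdsq.ne_zero), mul_one]
  · rw [map_div₀, AlgEquiv.commutes, hsfix g hgi hgd]

/-- HALVING at `(0,0) ∈ A₂` with a Galois-inert half: `φ_A(2i, 0) = (0, 0)`, and `(2i, 0)` is fixed by every `g` with
`g(i) = i`. (W2's `exists_φH_eq_some_of_eq_zero` with its witness exposed.) [cite: TianYuanZhang2017, Lemma 3.16 (p0017 L105–L113)] -/
theorem exists_φH_eq_some_of_eq_zero_fixed (D : GenusPointData n) {X Y : D.H}
    (h : (curveA.twoIsogenyCodomain.baseChange D.H).toAffine.Nonsingular X Y) (hX : X = 0) :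
    ∃ Q : APoint D.H, φH D Q = .some X Y h ∧ ∀ g : D.H ≃ₐ[ℚ] D.H, g D.im = D.im → D.galPt g Q = Q := by
  obtain ⟨-, h2, -, h4, -⟩ := curveA_baseChange_a (H := D.H)
  obtain ⟨k1, k2, k3, k4, k6⟩ := curveA₂_baseChange_a (H := D.H)
  have him := D.im_sq
  have hY : Y = 0 := by
    have := (Affine.equation_iff _ _).mp h.left
    rw [k1, k2, k3, k4, k6, hX] at this
    have hY2 : Y ^ 2 = 0 := by linear_combination this
    exact pow_eq_zero_iff (n := 2) (by norm_num) |>.mp hY2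
  have hi0 : (2 : D.H) * D.im ≠ 0 := mul_ne_zero two_ne_zero (fun h0 => by rw [h0] at him; norm_num at him)
  have hQns : (curveA.baseChange D.H).toAffine.Nonsingular (2 * D.im) 0 := by
    rw [curveA_nonsingular_iff]; linear_combination (-8 * D.im) * him
  refine ⟨.some (2 * D.im) 0 hQns, ?_, fun g hgi => ?_⟩
  · obtain ⟨h', e⟩ := twoIsogenyPointsHom_some curveA hQns hi0
    rw [φH, e, Point.some.injEq]
    constructor
    · rw [twoIsogenyX, h2, h4, hX, div_eq_iff hi0]
      linear_combination 4 * him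
    · rw [twoIsogenyY, hY, zero_mul, zero_div]
  · exact galPt_some_eq_of_fixed D g hQns (by rw [map_mul, map_ofNat, hgi]) (map_zero g)

/-- HALVING, generic case, with a Galois-inert half: `(X̄, Ȳ) = φ_A(q, wq)`, `X̄ = w²`, `q = (w³ + Ȳ)/(2w)` — and `(q, wq)` is fixed
by every `g` fixing `w` and `Ȳ`. (W2's `exists_φH_eq_some_of_sq` with its witness exposed.)
[cite: TianYuanZhang2017, §3.1 (p0011 L27–L36)] [cite: SilvermanAEC2009, Prop. X.4.9] -/
theorem exists_φH_eq_some_of_sq_fixed (D : GenusPointData n) {X Y w : D.H}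
    (h : (curveA.twoIsogenyCodomain.baseChange D.H).toAffine.Nonsingular X Y) (hw : w ≠ 0) (hX : X = w ^ 2) :
    ∃ Q : APoint D.H, φH D Q = .some X Y h ∧
      ∀ g : D.H ≃ₐ[ℚ] D.H, g w = w → g Y = Y → D.galPt g Q = Q := by
  obtain ⟨-, h2, -, h4, -⟩ := curveA_baseChange_a (H := D.H)
  obtain ⟨k1, k2, k3, k4, k6⟩ := curveA₂_baseChange_a (H := D.H)
  have hE : Y ^ 2 = w ^ 6 - 16 * w ^ 2 := by
    have := (Affine.equation_iff _ _).mp h.left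
    rw [k1, k2, k3, k4, k6, hX] at this
    linear_combination this
  have h2w : (2 : D.H) * w ≠ 0 := mul_ne_zero two_ne_zero hw
  set q : D.H := (w ^ 3 + Y) / (2 * w) with hq
  have hmul : q * (2 * w) = w ^ 3 + Y := by rw [hq, div_mul_cancel₀ _ h2w]
  have hquad : q ^ 2 - w ^ 2 * q + 4 = 0 := by
    have h4w : (4 * w ^ 2) * (q ^ 2 - w ^ 2 * q + 4) = 0 := by
      linear_combination (2 * w * q - w ^ 3 + Y) * hmul + hE
    exact (mul_eq_zero.mp h4w).resolve_left (mul_ne_zero (by norm_num) (pow_ne_zero 2 hw))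
  have hq0 : q ≠ 0 := by
    intro h0; rw [h0] at hquad; norm_num at hquad
  have hQns : (curveA.baseChange D.H).toAffine.Nonsingular q (w * q) := by
    rw [curveA_nonsingular_iff]; linear_combination (-q) * hquad
  refine ⟨.some q (w * q) hQns, ?_, fun g hgw hgY => ?_⟩
  · obtain ⟨h', e⟩ := twoIsogenyPointsHom_some curveA hQns hq0
    rw [φH, e, Point.some.injEq]
    constructor
    · rw [twoIsogenyX, h2, h4, hX, div_eq_iff hq0]
      linear_combination hquad
    · rw [twoIsogenyY, h4, div_eq_iff (pow_ne_zero 2 hq0)]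
      linear_combination q ^ 2 * hmul + (-(w * q)) * hquad
  · have hgq : g q = q := by
      rw [hq, map_div₀, map_add, map_pow, map_mul, map_ofNat, hgw, hgY]
    exact galPt_some_eq_of_fixed D g hQns hgq (by rw [map_mul, hgw, hgq])

/-- **THE HALVING WITH A GALOIS-INERT HALF** (the W2 lemma `twist_halving` with its witness exposed): for every rational
point `R` of `E_n` there is `Q₁ ∈ A(ℍ′_n)` with `φ_H(Q₁) = ι Θ_E(R)` which is FIXED by every automorphism of `ℍ′_n`
fixing `i` and all `√−d`, `d ∣ n` (its coordinates lie in `ℚ(i, √−n, √−d)`: `Q₁ = (q, wq)`, `w = 2t/√−n`, `x(R) = t²`,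
`q = (w³ + Y)/(2w)`). [cite: TianYuanZhang2017, §3.1 (p0011 L27–L36)] [cite: SilvermanAEC2009, Prop. X.4.9] -/
theorem exists_half_fixed (hsq : Squarefree n) (hn : n ∈ n.divisors) [(congruentNumberCurve n).IsElliptic]
    (D : GenusPointData n) (R : (congruentNumberCurve n).toAffine.Point) :
    ∃ Q₁ : APoint D.H, φH D Q₁ = Point.map (W' := curveA.twoIsogenyCodomain) (D.embK n hn) (ΘE hsq.ne_zero R) ∧
      ∀ g : D.H ≃ₐ[ℚ] D.H, g D.im = D.im → (∀ d ∈ n.divisors, g (D.sqrtNeg d) = D.sqrtNeg d) → D.galPt g Q₁ = Q₁ := by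
  have hn0 := hsq.ne_zero
  rcases R with _ | ⟨x, y, h⟩
  · exact ⟨0, by rw [← Point.zero_def, map_zero, map_zero, map_zero], fun g _ _ => map_zero _⟩
  · obtain ⟨h₃, e₃⟩ := ΘE_some hn0 h
    rw [e₃, Point.map_some]
    have hθ : D.embK n hn (θn n) = D.sqrtNeg n := AdjoinRoot.liftAlgHom_root _ _ _ _
    have hs : D.sqrtNeg n ^ 2 = -(n : D.H) := D.sqrtNeg_sq n hn
    -- the embedded coordinates are fixed by every `g` fixing `√−n`
    have hfixK : ∀ g : D.H ≃ₐ[ℚ] D.H, g (D.sqrtNeg n) = D.sqrtNeg n → ∀ z : GenusField n,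
        g (D.embK n hn z) = D.embK n hn z := fun g hgK z => by
      have := AlgHom.congr_fun (algHom_comp_embK_eq D hn g hgK) z
      simpa using this
    by_cases hx : x = 0
    · refine (exists_φH_eq_some_of_eq_zero_fixed D _ ?_).imp fun Q hQ => ⟨hQ.1, fun g hgi _ => hQ.2 g hgi⟩
      rw [hx, mul_zero, map_zero, mul_zero, map_zero]
    · obtain ⟨t, ht0, htx, htfix⟩ := exists_sq_eq_x_fixed D hsq h hx
      have hsn0 : D.sqrtNeg n ≠ 0 := fun h0 => by
        rw [h0, zero_pow two_ne_zero, zero_eq_neg, Nat.cast_eq_zero] at hs; exact hn0 hs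
      have hw : (2 * t / D.sqrtNeg n) ≠ 0 := div_ne_zero (mul_ne_zero two_ne_zero ht0) hsn0
      refine (exists_φH_eq_some_of_sq_fixed D _ hw ?_).imp fun Q hQ =>
        ⟨hQ.1, fun g hgi hgd => hQ.2 g ?_ (hfixK g (hgd n hn) _)⟩
      · rw [map_mul, map_inv₀, map_pow, hθ, AlgHom.commutes, map_mul, map_ofNat, htx, div_pow, hs]
        field_simp
        ring
      · rw [map_div₀, map_mul, map_ofNat, htfix g hgi hgd, hgd n hn]

/-! ## §2 A mover makes `P(n)` non-torsion and `𝓛(n)` non-zero -/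

/-- A point moved by an automorphism fixing `i` is NOT torsion (odd `n`, Lemma 3.18).
[cite: TianYuanZhang2017, Lemma 3.18 (p0017 L152–L153)] -/
theorem not_isOfFinAddOrder_of_mover (D : GenusPointData n) (hodd : Odd n) (h318 : D.lemma318)
    (g : D.H ≃ₐ[ℚ] D.H) (hgi : g D.im = D.im) {X : APoint D.H} (hmove : D.galPt g X ≠ X) :
    ¬ IsOfFinAddOrder X :=
  fun hX => hmove (galPt_eq_self_of_isOfFinAddOrder D hodd h318 g hgi hX)

/-- **A mover of `P(n)` forces `𝓛(n) ≠ 0`** (Thm 3.5: `𝓛(n) = 0` makes `P(n)` torsion, which no `g` fixing `i` can move).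
[cite: TianYuanZhang2017, Thm. 3.5 (p0011 L94–L100), Lemma 3.18 (p0017 L152–L153)] -/
theorem scriptL_ne_zero_of_mover (hsq : Squarefree n) (hodd : Odd n) (D : GenusPointData n)
    (h35 : D.thm35Main) (h318 : D.lemma318)
    (g : D.H ≃ₐ[ℚ] D.H) (hgi : g D.im = D.im) (hmove : D.galPt g (D.P n) ≠ D.P n) :
    D.scriptL n ≠ 0 := by
  haveI := isElliptic_congruentNumberCurve hsq.ne_zero
  intro h0
  obtain ⟨ρ, hρ⟩ := stub_S3 hsq
  exact not_isOfFinAddOrder_of_mover D hodd h318 g hgi hmove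
    ((h35 (Nat.mem_divisors_self n hsq.ne_zero) ρ hρ).1 h0)

/-! ## §3 The door: `#Sel₂ = 8` + a mover ⟹ `𝓛(n)` odd, analytic rank one, rank one, `Ш[2^∞] = 0`, BSD₂ -/

/-- **`#Sel₂ = 8` + A MOVER ⟹ `𝓛(n)` ODD AND `rank E_n(ℚ) = 1`** (no GZK): square-free `n ≡ 5, 7 (mod 8)`, `#Sel⁽²⁾(E_n/ℚ) = 8`,
data `D` with Thm 3.5's main clause, integrality and Lemma 3.18, and `g ∈ Aut_ℚ(ℍ′_n)` fixing `i` and every `√−d` (`d ∣ n`)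
with `g·P(n) ≠ P(n)`.  Then `rank E_n(ℚ) = 1` and `¬ 2 ∣ L` for every `L` with `𝓛(n)² = L²`.
[cite: TianYuanZhang2017, Thm. 3.5 (p0011 L94–L100), Lemma 3.18 (p0017 L152–L153)] [cite: SilvermanAEC2009, Thm. X.4.2, Prop. X.4.9] -/
theorem rankOne_and_odd_scriptL_of_selmerEight_of_mover (hsq : Squarefree n) (h8 : n % 8 = 5 ∨ n % 8 = 7)
    (hsel : haveI := isElliptic_congruentNumberCurve hsq.ne_zero;
      Nat.card ((congruentNumberCurve n).selmerGroup 2) = 8)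
    (D : GenusPointData n) (h35 : D.thm35Main) (hLs : D.scriptLSpec) (h318 : D.lemma318)
    (g : D.H ≃ₐ[ℚ] D.H) (hgi : g D.im = D.im) (hgd : ∀ d ∈ n.divisors, g (D.sqrtNeg d) = D.sqrtNeg d)
    (hmove : D.galPt g (D.P n) ≠ D.P n) :
    haveI := isElliptic_congruentNumberCurve hsq.ne_zero
    (congruentNumberCurve n).mordellWeilRank = 1 ∧ ∀ L : ℤ, IsScriptL n L → ¬ (2 : ℤ) ∣ L := by
  have hn0 : n ≠ 0 := hsq.ne_zero
  haveI := isElliptic_congruentNumberCurve hn0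
  have hodd : Odd n := by rcases h8 with h | h <;> exact Nat.odd_iff.mpr (by omega)
  have hn : n ∈ n.divisors := Nat.mem_divisors_self n hn0
  have hn1 : 1 < n := by rcases h8 with h | h <;> omega
  have hLD : IsScriptL n (D.scriptL n) := hLs n hn hn1
  have hL0 : D.scriptL n ≠ 0 := scriptL_ne_zero_of_mover hsq hodd D h35 h318 g hgi hmove
  have hPnt : ¬ IsOfFinAddOrder (D.P n) := not_isOfFinAddOrder_of_mover D hodd h318 g hgi hmove
  -- `2`-descent: rank ≤ 1 with the dichotomy
  have hcases := mordellWeilRank_card_sha_two_cases_of_card_selmerGroup_two_eq_eight hn0 hsel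
  have hr1 : (congruentNumberCurve n).mordellWeilRank ≤ 1 := by
    rcases hcases with ⟨h, -⟩ | ⟨h, -⟩ <;> omega
  obtain ⟨R, hR⟩ := stub_S0 (n := n) hr1
  obtain ⟨Q₁, hQ₁, hQfix⟩ := exists_half_fixed hsq hn D R
  obtain ⟨u, hu, hrel⟩ := two_smul_genusPoint_sub_smul_half_isOfFinAddOrder hsq hr1 D h35 hL0 hR hQ₁
  -- rank `0` is impossible: `R`, hence `Q₁`, hence `2P(n)`, hence `P(n)` would be torsion
  have hrank : (congruentNumberCurve n).mordellWeilRank = 1 := by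
    rcases hcases with ⟨h, -⟩ | ⟨h0, -⟩
    · exact h
    · exfalso
      haveI : Finite (congruentNumberCurve n).toAffine.Point :=
        (congruentNumberCurve n).mordellWeilRank_eq_zero_iff_finite.mp h0
      have hRt : IsOfFinAddOrder R := isOfFinAddOrder_of_finite R
      have hQt : IsOfFinAddOrder Q₁ := by
        have hφt : IsOfFinAddOrder (φH D Q₁) := by
          rw [hQ₁]; exact AddMonoidHom.isOfFinAddOrder _ (AddMonoidHom.isOfFinAddOrder _ hRt)
        obtain ⟨m, hm, hmQ⟩ := (isOfFinAddOrder_iff_nsmul_eq_zero).mp hφt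
        have hker : φH D (m • Q₁) = 0 := by rw [map_nsmul, hmQ]
        have h2m : (2 * m) • Q₁ = 0 := by
          rw [mul_comm, mul_nsmul]
          rcases (φH_eq_zero_iff D _).mp hker with e | e
          · rw [e, smul_zero]
          · rw [e, two_nsmul_tauOne]
        exact isOfFinAddOrder_iff_nsmul_eq_zero.mpr ⟨2 * m, by omega, h2m⟩
      apply hPnt
      have h2P : IsOfFinAddOrder ((2 : ℤ) • D.P n) := by
        have e : (2 : ℤ) • D.P n = ((2 : ℤ) • D.P n - (u * D.scriptL n) • Q₁) + (u * D.scriptL n) • Q₁ := by abel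
        rw [e]; exact hrel.add hQt.zsmul
      exact LevelTwo.isOfFinAddOrder_of_zsmul two_ne_zero h2P
  refine ⟨hrank, fun L hL h2 => ?_⟩
  have h2' : (2 : ℤ) ∣ D.scriptL n := by
    rcases LevelTwo.eq_or_eq_neg_of_isScriptL hL hLD with e | e
    · rwa [← e]
    · rw [← dvd_neg, ← e]; exact h2
  obtain ⟨c, hc⟩ := h2'
  have ht : IsOfFinAddOrder (D.P n - (u * c) • Q₁) := by
    have e : (2 : ℤ) • D.P n - (u * D.scriptL n) • Q₁ = (2 : ℤ) • (D.P n - (u * c) • Q₁) := by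
      rw [hc]; module
    rw [e] at hrel
    exact LevelTwo.isOfFinAddOrder_of_zsmul two_ne_zero hrel
  apply hmove
  have eP : D.P n = (D.P n - (u * c) • Q₁) + (u * c) • Q₁ := by abel
  rw [eP, map_add, map_zsmul, galPt_eq_self_of_isOfFinAddOrder D hodd h318 g hgi ht, hQfix g hgi hgd]

/-- **THE GALOIS-MOVER DOOR.**  Square-free `n ≡ 5, 7 (mod 8)` with `#Sel⁽²⁾(E_n/ℚ) = 8`; `D : GenusPointData n` with the displayed
main clause of Thm 3.5, integrality and Lemma 3.18; an automorphism `g` of `ℍ′_n` fixing `i` and every `√−d` (`d ∣ n`) that MOVES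
`P(n)`.  Then **`ord_{s=1} L(E_n, s) = 1`, `rank E_n(ℚ) = 1`, `Ш(E_n)[2^∞] = 0` and `BSD(E_n, 2)`** — no Gross–Zagier–Kolyvagin,
no genus-sum parity.  (`𝓛(n)` odd ⟹ `r_an = 1`; `#Sel₂ = 8` and rank `1` ⟹ `Ш[2^∞] = ⊥`; `L′(E_n,1) = 2^{2k−2−a}𝓛²·Ω·Reg`,
`#E_n(ℚ)_tor = 4`, `∏c_ℓ = 2^{2k+2−a}` ⟹ Miller's `BSD(E_n,2)`.)  The mover exists (class field theory, LEAD note §4/§6,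
instrument `k3_layer1.py`) e.g. for `n = pqr`, `p ≡ 5`, `q ≡ r ≡ 7 (mod 8)`, `(p/q) = (p/r) = −1` — a TYZ-silent family.
[cite: TianYuanZhang2017, Thm. 3.5 and §1 (1.1)] [cite: SilvermanAEC2009, Thm. X.4.2] [cite: Miller2011LMS, Def. 1.1 (arXiv:1010.2431 p. 3)] -/
theorem rankOne_sha_bsdp_two_congruentNumberCurve_of_selmerEight_of_mover (hsq : Squarefree n)
    (h8 : n % 8 = 5 ∨ n % 8 = 7)
    (hsel : haveI := isElliptic_congruentNumberCurve hsq.ne_zero;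
      Nat.card ((congruentNumberCurve n).selmerGroup 2) = 8)
    (D : GenusPointData n) (h35 : D.thm35Main) (hLs : D.scriptLSpec) (h318 : D.lemma318)
    (g : D.H ≃ₐ[ℚ] D.H) (hgi : g D.im = D.im) (hgd : ∀ d ∈ n.divisors, g (D.sqrtNeg d) = D.sqrtNeg d)
    (hmove : D.galPt g (D.P n) ≠ D.P n) :
    haveI := isElliptic_congruentNumberCurve hsq.ne_zero
    (congruentNumberCurve n).analyticRank = 1 ∧ (congruentNumberCurve n).mordellWeilRank = 1 ∧
      AddCommGroup.primaryComponent (congruentNumberCurve n).sha 2 = ⊥ ∧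
      BSDp (congruentNumberCurve n) 2 := by
  have hn0 : n ≠ 0 := hsq.ne_zero
  haveI := isElliptic_congruentNumberCurve hn0
  haveI : Fact (Nat.Prime 2) := ⟨Nat.prime_two⟩
  have h8' : n % 8 = 5 ∨ n % 8 = 6 ∨ n % 8 = 7 := by rcases h8 with h | h <;> omega
  have hn : n ∈ n.divisors := Nat.mem_divisors_self n hn0
  have hn1 : 1 < n := by rcases h8 with h | h <;> omega
  have hLD : IsScriptL n (D.scriptL n) := hLs n hn hn1
  obtain ⟨hrank, hoddL⟩ :=
    rankOne_and_odd_scriptL_of_selmerEight_of_mover hsq h8 hsel D h35 hLs h318 g hgi hgd hmove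
  have hLodd : Odd (D.scriptL n) := Int.not_even_iff_odd.mp fun he => hoddL _ hLD (even_iff_two_dvd.mp he)
  have hL0 : D.scriptL n ≠ 0 := fun h => by simp [h] at hLodd
  have hr1 : (congruentNumberCurve n).analyticRank = 1 :=
    analyticRank_congruentNumberCurve_eq_one_of_isScriptL hsq h8' hLD hL0
  have hbot := P2.primaryComponent_sha_two_eq_bot_of_card_selmerGroup_eq_eight hn0 hrank hsel
  refine ⟨hr1, hrank, hbot, ?_⟩
  have hlead : (congruentNumberCurve n).leadingLCoeff =
      (((2 : ℚ) ^ twoExponent n * (D.scriptL n : ℚ) ^ 2 : ℚ) : ℂ) *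
        ((congruentNumberCurve n).realPeriodRat : ℂ) * ((congruentNumberCurve n).regulator : ℂ) := by
    rw [leadingLCoeff_congruentNumberCurve_eq_of_isScriptL (Nat.pos_of_ne_zero hn0) hr1 hLD]
    push_cast; ring
  have hx0 : (2 : ℚ) ^ twoExponent n * (D.scriptL n : ℚ) ^ 2 ≠ 0 := by
    have hL0' : (D.scriptL n : ℚ) ≠ 0 := by exact_mod_cast hL0
    exact mul_ne_zero (zpow_ne_zero _ two_ne_zero) (pow_ne_zero _ hL0')
  rw [P2.bsdp_iff_valuation_of_leadingLCoeff_of_primaryComponent_eq_bot (congruentNumberCurve n) 2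
    (hrank.trans hr1.symm) hx0 hlead hbot, P2.padicValRat_two_zpow_mul_sq hLodd,
    tamagawaProduct_congruentNumberCurve_eq_two_pow hsq, torsionOrder_congruentNumberCurve hsq,
    padicValNat.prime_pow, show (4 : ℕ) = 2 ^ 2 by norm_num, padicValNat.prime_pow]
  unfold twoExponent oddPrimeFactorCount oddIndicator
  split_ifs <;> push_cast <;> omega

/-! ## §4 Keyed on the named fact -/

/-- **The Galois-mover door from the named fact `tyz_genusPointData`** (TYZ §3 AS PRINTED): for square-free `n ≡ 5, 7 (mod 8)`
with `#Sel⁽²⁾(E_n/ℚ) = 8`, IF for the printed data some automorphism of `ℍ′_n` trivial on `i` and the `√−d` moves `P(n)`, then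
`ord = rank = 1`, `Ш[2^∞] = 0`, `BSD(E_n, 2)`.  (The data are existential in the fact, so the mover hypothesis is stated for
every datum satisfying the displays.) [cite: TianYuanZhang2017, Thm. 3.5 and Lemma 3.18] [cite: Miller2011LMS, Def. 1.1] -/
theorem rankOne_sha_bsdp_two_congruentNumberCurve_of_selmerEight_of_mover_of_tyz (hTYZ : tyz_genusPointData)
    (hsq : Squarefree n) (h8 : n % 8 = 5 ∨ n % 8 = 7)
    (hsel : haveI := isElliptic_congruentNumberCurve hsq.ne_zero;
      Nat.card ((congruentNumberCurve n).selmerGroup 2) = 8)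
    (hmover : ∀ D : GenusPointData n, D.Printed →
      ∃ g : D.H ≃ₐ[ℚ] D.H, g D.im = D.im ∧ (∀ d ∈ n.divisors, g (D.sqrtNeg d) = D.sqrtNeg d) ∧
        D.galPt g (D.P n) ≠ D.P n) :
    haveI := isElliptic_congruentNumberCurve hsq.ne_zero
    (congruentNumberCurve n).analyticRank = 1 ∧ (congruentNumberCurve n).mordellWeilRank = 1 ∧
      AddCommGroup.primaryComponent (congruentNumberCurve n).sha 2 = ⊥ ∧
      BSDp (congruentNumberCurve n) 2 := by
  have h8' : n % 8 = 5 ∨ n % 8 = 6 ∨ n % 8 = 7 := by rcases h8 with h | h <;> omega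
  obtain ⟨D, hD⟩ := hTYZ n hsq h8'
  obtain ⟨g, hgi, hgd, hmove⟩ := hmover D hD
  obtain ⟨hLs, -, -, -, h35, -, -, -, h318, -, -⟩ := hD
  exact rankOne_sha_bsdp_two_congruentNumberCurve_of_selmerEight_of_mover hsq h8 hsel D h35 hLs h318 g hgi hgd hmove

end Summit.BirchSwinnertonDyer.PrintCf2.GaloisMotion

end
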